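import Literature.Computability.AlgebraicComplexity.MS21ReadOnceOrbitsProofs
import Literature.Computability.AlgebraicComplexity.MS21IndependentMapLemmas
import HarnessLib

/-!
# Medini–Shpilka 2021, Thm 33: `(t+1)`-independent maps hit the affine orbits of read-once
# formulas on `≤ 2^t` variables (`MS2021_thm_33_holds`)

Theorem-only companion of `MS21DenseOrbitsHittingSets.lean` (cell `val-lit`, seat t18 g5): a PROOF
of the typed fact `MS2021_thm_33` — "Let `0 ≠ f ∈ ROF^{GLaff_n(F)}` where the underlying ROF depends
on `2^t` variables, for `2^t ≤ n`. Then, for any `(t+1)`-independent polynomial map `G`, over `F`,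
`f ∘ G ≠ 0`" — following the printed proof [MediniShpilka2021, §5.1 proof of ‹thm:PITROPINV›,
arXiv:2102.05632 p0026:L29–L48] step by step. The printed proof establishes the STRONGER claim

> "Let `Φ` be a ROF on `m ≤ 2^t` many variables that computes a non-constant polynomial. Then, for
> `f ∈ Φ^{GLaff_n(F)}` and any `(t+1)`-independent map `G`, over `F`, `f ∘ G` is a non-constant
> polynomial"

by induction on `m` (`MS2021.totalDegree_bind₁_affSubst_ne_zero_of_isROP`, here by strong induction
on the number of leaves `|S|` of the tree's read-once predicate `MS2021.IsROP S g`), with the printed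
case analysis on the top gate:

* `Φ = Φ₁ + Φ₂ + α`: the side with at most `m/2 ≤ 2^{t-1}` leaves, say `Φ₁`, has a leaf `w_i` with
  `∂Φ₁/∂w_i ≠ 0`; `∂f/∂v_i = (∂Φ₁/∂w_i)(ℓ_1, …, ℓ_m)` for the dual vector `v_i` (Lemma 3.8 — the
  §3 toolkit's `MS2021.sum_C_mul_pderiv_affSubst`, `MS21IndependentMapLemmas.lean`, seat t24 g5);
  by induction `(∂f/∂v_i) ∘ G_t` is non-constant (or a nonzero constant) for the `t`-independent
  part `G_t` of `G = G_1 + G_t` (Obs 3.1 (1), toolkit `MS2021.isIndependent_succ_iff`), and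
  Lemma 3.9 in non-constancy form (`MS2021.totalDegree_bind₁_ne_zero_of_isOneIndependent`, from the
  toolkit's `MS2021.bind₁_sum_ne_zero_of_pderiv` applied to `f - c`) gives that `f ∘ G` is
  non-constant. (If the smaller side is constant the claim is the induction hypothesis for the
  other side.)
* `Φ = Φ₁ × Φ₂ + α`: both factors nonzero, at least one non-constant, so `f ∘ G = (f₁ ∘ G)(f₂ ∘ G) + α`
  is non-constant (degrees add over a field).
* a leaf `α w_i + β`, `α ≠ 0`: `∂f/∂x_j = α A_{ij}` is a nonzero constant for some `j` (the rows of
  an invertible `A` are nonzero), and Lemma 3.9 applies directly (the printed (obs:kwise)).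

Read-once structure lemmas proved on the way (Def 5): the variables of a read-once polynomial lie
in its leaf set, partial derivatives of read-once polynomials are read-once on the same leaf set
(replace the leaf `αw_i + β` by the constant leaf `0·w_i + α`), and a non-constant read-once
polynomial has a nonzero partial derivative at some leaf.

No new definitions, no new facts (D-0026): net debt `−1`. HONEST FRAMING: a known 2021 result is
now a theorem of the tree; typed ≠ endorsed; `VP ≠ VNP` is NOT proved and this is no progress on it.

## References
* [MediniShpilka2021] D. Medini, A. Shpilka, CCC 2021 (LIPIcs 200:19) Thm 33 (p.19:13) and its proof,
  §5.1 of arXiv:2102.05632 (held text p0026:L29–L48); §3 Obs 3.1, Def 3.6–3.7, Lemma 3.8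
  (p0017:L44–L62), Lemma 3.9 (p0017:L64 – p0018:L12); Def 19 (`k`-independent maps).
* [ShpilkaVolkovich2015] A. Shpilka, I. Volkovich, *Read-once polynomial identity testing*,
  Comput. Complexity 24 (2015), Lemma 5.1 (the ROF case analysis the printed proof follows).
-/

noncomputable section

open MvPolynomial Matrix

namespace Literature.Computability.AlgebraicComplexity

namespace MS2021

/-! ### Read-once polynomials: variables, partial derivatives, non-constancy (Def 5) -/

section ROPStructure

variable {K : Type*} [Field K] {σ : Type*} [DecidableEq σ]

/-- The variables of a read-once polynomial lie in its leaf set ("each input variable can label at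
most one leaf"; a leaf `αx_i + β` involves at most `x_i`). [cite: MediniShpilka2021, Def 5 (CCC p.19:6; arXiv p0025:L8-L10)] -/
theorem IsROP.vars_subset {S : Finset σ} {f : MvPolynomial σ K} (h : IsROP S f) : f.vars ⊆ S := by
  induction h with
  | leaf i α β =>
      refine (vars_add_subset _ _).trans (Finset.union_subset ?_ ?_)
      · refine (vars_mul _ _).trans (Finset.union_subset ?_ ?_)
        · rw [vars_C]; exact Finset.empty_subset _
        · rw [vars_X]
      · rw [vars_C]; exact Finset.empty_subset _
  | add α _ _ _ ih₁ ih₂ =>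
      refine (vars_add_subset _ _).trans (Finset.union_subset ?_ ?_)
      · exact (vars_add_subset _ _).trans (Finset.union_subset
          (ih₁.trans Finset.subset_union_left) (ih₂.trans Finset.subset_union_right))
      · rw [vars_C]; exact Finset.empty_subset _
  | mul α _ _ _ ih₁ ih₂ =>
      refine (vars_add_subset _ _).trans (Finset.union_subset ?_ ?_)
      · exact (vars_mul _ _).trans (Finset.union_subset
          (ih₁.trans Finset.subset_union_left) (ih₂.trans Finset.subset_union_right))
      · rw [vars_C]; exact Finset.empty_subset _

/-- A read-once polynomial does not depend on variables outside its leaf set: `∂f/∂x_i = 0` for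
`i ∉ S`. [cite: MediniShpilka2021, Def 5 (CCC p.19:6)] -/
theorem IsROP.pderiv_eq_zero_of_not_mem {S : Finset σ} {f : MvPolynomial σ K} (h : IsROP S f)
    {i : σ} (hi : i ∉ S) : pderiv i f = 0 :=
  pderiv_eq_zero_of_notMem_vars fun hv => hi (h.vars_subset hv)

/-- A constant is computed by the read-once formula with the single leaf `0·x_i + c`.
[cite: MediniShpilka2021, Def 5 (CCC p.19:6 "computes the polynomial `α x_i + β`")] -/
theorem IsROP.const (i : σ) (c : K) : IsROP ({i} : Finset σ) (C c : MvPolynomial σ K) := by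
  simpa only [C_0, zero_mul, zero_add] using IsROP.leaf (K := K) i 0 c

/-- **Partial derivatives of read-once polynomials are read-once on the same leaf set** (replace the
leaf `αx_i + β` by the constant leaf `α`; at a `×` gate only the factor containing `x_i` is
differentiated, the other factor being free of `x_i`) — the fact behind "By our induction
hypothesis, `(∂f/∂v_1) ∘ G_t` is a non-constant polynomial" in the printed proof.
[cite: MediniShpilka2021, §5.1 proof of Thm 33 (arXiv p0026:L42-L44)] -/
theorem IsROP.isROP_pderiv {S : Finset σ} {f : MvPolynomial σ K} (h : IsROP S f) (i : σ) :
    IsROP S (pderiv i f) := by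
  induction h with
  | leaf j α β =>
      have : pderiv i (C α * X j + C β : MvPolynomial σ K) = C (if j = i then α else 0) := by
        classical
        rw [map_add, pderiv_C, add_zero, pderiv_C_mul, pderiv_X]
        simp only [Pi.single_apply]
        split_ifs <;> simp
      rw [this]
      exact IsROP.const j _
  | @add S₁ S₂ f g α hf hg hd ih₁ ih₂ =>
      have : pderiv i (f + g + C α) = pderiv i f + pderiv i g + C 0 := by
        rw [map_add, map_add, pderiv_C, C_0]
      rw [this]
      exact IsROP.add 0 ih₁ ih₂ hd
  | @mul S₁ S₂ f g α hf hg hd ih₁ ih₂ =>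
      by_cases hi : i ∈ S₂
      · have hi₁ : i ∉ S₁ := fun h₁ => Finset.disjoint_left.mp hd h₁ hi
        have : pderiv i (f * g + C α) = f * pderiv i g + C 0 := by
          rw [map_add, pderiv_mul, pderiv_C, hf.pderiv_eq_zero_of_not_mem hi₁, zero_mul, zero_add,
            C_0]
        rw [this]
        exact IsROP.mul 0 hf ih₂ hd
      · have : pderiv i (f * g + C α) = pderiv i f * g + C 0 := by
          rw [map_add, pderiv_mul, pderiv_C, hg.pderiv_eq_zero_of_not_mem hi, mul_zero, add_zero,
            C_0]
        rw [this]
        exact IsROP.mul 0 ih₁ hg hd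

/-- **A non-constant read-once polynomial has a nonzero partial derivative at one of its leaves**
("Assume further, WLOG, that `∂Φ₁/∂w_1 ≠ 0`" for the non-constant `Φ₁`): read-once polynomials are
multilinear in their leaves. [cite: MediniShpilka2021, §5.1 proof of Thm 33 (arXiv p0026:L42); Remark after Def 5 (arXiv p0025:L13 "Read-once polynomials are always multilinear polynomials")] -/
theorem IsROP.exists_pderiv_ne_zero {S : Finset σ} {f : MvPolynomial σ K} (h : IsROP S f)
    (hf : f.totalDegree ≠ 0) : ∃ i ∈ S, pderiv i f ≠ 0 := by
  induction h with
  | leaf i α β =>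
      refine ⟨i, Finset.mem_singleton_self i, ?_⟩
      have hα : α ≠ 0 := by
        rintro rfl
        apply hf
        rw [C_0, zero_mul, zero_add, totalDegree_C]
      classical
      rw [map_add, pderiv_C, add_zero, pderiv_C_mul, pderiv_X]
      simp only [Pi.single_eq_same, mul_one, ne_eq, C_eq_zero]
      exact hα
  | @add S₁ S₂ f g α hfR hgR hd ih₁ ih₂ =>
      -- one of the two summands is non-constant
      by_cases hf0 : f.totalDegree = 0
      · have hg0 : g.totalDegree ≠ 0 := by
          intro hg0
          apply hf
          rw [totalDegree_eq_zero_iff_eq_C] at hf0 hg0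
          rw [hf0, hg0, ← C_add, ← C_add, totalDegree_C]
        obtain ⟨i, hi, hne⟩ := ih₂ hg0
        refine ⟨i, Finset.mem_union_right _ hi, ?_⟩
        have hi₁ : i ∉ S₁ := fun h₁ => Finset.disjoint_left.mp hd h₁ hi
        rwa [map_add, map_add, pderiv_C, add_zero, hfR.pderiv_eq_zero_of_not_mem hi₁, zero_add]
      · obtain ⟨i, hi, hne⟩ := ih₁ hf0
        refine ⟨i, Finset.mem_union_left _ hi, ?_⟩
        have hi₂ : i ∉ S₂ := fun h₂ => Finset.disjoint_left.mp hd hi h₂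
        rwa [map_add, map_add, pderiv_C, add_zero, hgR.pderiv_eq_zero_of_not_mem hi₂, add_zero]
  | @mul S₁ S₂ f g α hfR hgR hd ih₁ ih₂ =>
      -- the product is non-constant, so both factors are nonzero and one is non-constant
      have hfg : (f * g).totalDegree ≠ 0 := by
        intro h0
        apply hf
        rw [totalDegree_eq_zero_iff_eq_C] at h0
        rw [h0, ← C_add, totalDegree_C]
      have hf0 : f ≠ 0 := by rintro rfl; exact hfg (by rw [zero_mul, totalDegree_zero])
      have hg0 : g ≠ 0 := by rintro rfl; exact hfg (by rw [mul_zero, totalDegree_zero])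
      rw [totalDegree_mul_of_isDomain hf0 hg0] at hfg
      by_cases hfd : f.totalDegree = 0
      · have hgd : g.totalDegree ≠ 0 := by omega
        obtain ⟨i, hi, hne⟩ := ih₂ hgd
        refine ⟨i, Finset.mem_union_right _ hi, ?_⟩
        have hi₁ : i ∉ S₁ := fun h₁ => Finset.disjoint_left.mp hd h₁ hi
        rw [map_add, pderiv_mul, pderiv_C, add_zero, hfR.pderiv_eq_zero_of_not_mem hi₁, zero_mul,
          zero_add]
        exact mul_ne_zero hf0 hne
      · obtain ⟨i, hi, hne⟩ := ih₁ hfd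
        refine ⟨i, Finset.mem_union_left _ hi, ?_⟩
        have hi₂ : i ∉ S₂ := fun h₂ => Finset.disjoint_left.mp hd hi h₂
        rw [map_add, pderiv_mul, pderiv_C, add_zero, hgR.pderiv_eq_zero_of_not_mem hi₂, mul_zero,
          add_zero]
        exact mul_ne_zero hne hg0

end ROPStructure

/-! ### Lemma 3.9 (`k = 1`) in non-constancy form, and Obs 3.1 (1) (peeling) — on top of the
§3 toolkit `MS21IndependentMapLemmas.lean` -/

section Lemma39

variable {K : Type*} [Field K] {n t : ℕ} {ρ : Type*}

/-- Injective renamings preserve non-constancy. [folklore] -/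
private theorem totalDegree_rename_ne_zero {σ τ : Type*} {e : σ → τ} (he : Function.Injective e)
    {p : MvPolynomial σ K} (hp : p.totalDegree ≠ 0) : (rename e p).totalDegree ≠ 0 := by
  intro h
  rw [totalDegree_eq_zero_iff_eq_C] at h
  apply hp
  have hpC : p = C (coeff 0 (rename e p)) :=
    rename_injective e he (by rw [rename_C]; exact h)
  rw [hpC, totalDegree_C]

/-- **Lemma 3.9 for `k = 1`** (lem:indDerivLinear) in the NON-CONSTANCY form its proof gives and the
§5.1 induction needs: if `(∂f/∂x_{j₀}) ∘ H ≠ 0` and `G_1` is a `1`-independent map in variables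
disjoint from those of `H`, then `f ∘ (G_1 + H)` is a non-constant polynomial ("`g` … is a projection
of `f ∘ (G + H)`" with `∂g/∂z_1 ≠ 0`). Here from the toolkit's `≠ 0` form
(`MS2021.bind₁_sum_ne_zero_of_pderiv`) applied to `f - c` for the would-be constant value `c`,
which has the same partial derivatives. [cite: MediniShpilka2021, Lemma 3.9 and its proof (arXiv p0017:L64 – p0018:L12)] -/
theorem totalDegree_bind₁_ne_zero_of_isOneIndependent
    (G₁ : Fin n → MvPolynomial (Fin t ⊕ Unit) K) (hG₁ : IsOneIndependent G₁)
    (H : Fin n → MvPolynomial ρ K) (f : MvPolynomial (Fin n) K) (j₀ : Fin n)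
    (hj : bind₁ H (pderiv j₀ f) ≠ 0) :
    (bind₁ (fun j => rename Sum.inl (G₁ j) + rename Sum.inr (H j)) f).totalDegree ≠ 0 := by
  intro hdeg
  rw [totalDegree_eq_zero_iff_eq_C] at hdeg
  obtain ⟨c, hc⟩ : ∃ c : K, bind₁ (fun j => rename Sum.inl (G₁ j) + rename Sum.inr (H j)) f = C c :=
    ⟨_, hdeg⟩
  have hj' : bind₁ H (pderiv j₀ (f - C c)) ≠ 0 := by
    rwa [map_sub, pderiv_C, sub_zero]
  exact bind₁_sum_ne_zero_of_pderiv hG₁ H (f - C c) j₀ hj' (by rw [map_sub, bind₁_C_right, hc, sub_self])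

/-- **Lemma 3.9 (`k = 1`) combined with Obs 3.1 (1)** ("Let `G_1, G_t` be a `1`-independent and a
`t`-independent map, respectively, such that `G = G_1 + G_t`"), the form the inductive proof of
Thm 33 uses: if for every `k`-independent map `G'` some first-order partial derivative `∂f/∂x_j`
survives composition with `G'`, then `f ∘ G` is non-constant for every `(k+1)`-independent map `G`
(peel `G = G_1 + G'` with the toolkit's `MS2021.isIndependent_succ_iff`, apply Lemma 3.9 to `G_1` and
`H = G'`, transport along `MS2021.bind₁_peel_eq_rename`).
[cite: MediniShpilka2021, Lemma 3.9 with Obs 3.1 (1) (arXiv p0017:L8, p0017:L64 – p0018:L12; §5.1 p0026:L40)] -/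
theorem totalDegree_bind₁_ne_zero_of_isIndependent_succ {k : ℕ}
    {G : Fin n → MvPolynomial (Fin (k + 1) × (Fin t ⊕ Unit)) K} (hG : IsIndependent (k + 1) G)
    (f : MvPolynomial (Fin n) K)
    (hf : ∀ G' : Fin n → MvPolynomial (Fin k × (Fin t ⊕ Unit)) K, IsIndependent k G' →
      ∃ j₀, bind₁ G' (pderiv j₀ f) ≠ 0) :
    (bind₁ G f).totalDegree ≠ 0 := by
  obtain ⟨G₁, G', hG₁, hG', hGeq⟩ := isIndependent_succ_iff.mp hG
  obtain ⟨j₀, hj₀⟩ := hf G' hG'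
  have key := totalDegree_bind₁_ne_zero_of_isOneIndependent G₁ hG₁ G' f j₀ hj₀
  have hGfun : G = fun j => rename (Prod.mk 0) (G₁ j) + rename (Prod.map Fin.succ id) (G' j) :=
    funext hGeq
  rw [hGfun, bind₁_peel_eq_rename]
  exact totalDegree_rename_ne_zero sumElim_prodMk_injective key

end Lemma39

/-! ### Lemma 3.8 (dual-set derivative), the consequence used in the induction -/

section Lemma38

variable {K : Type*} [Field K] {m n : ℕ}

/-- `f ↦ f(Ax + b)` is additive (it is an algebra homomorphism). [cite: MediniShpilka2021, §1.1.6 eq. (2) (CCC p.19:9)] -/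
theorem affSubst_add (h : m ≤ n) (A : Matrix (Fin n) (Fin n) K) (b : Fin n → K)
    (p q : MvPolynomial (Fin m) K) : affSubst h A b (p + q) = affSubst h A b p + affSubst h A b q := by
  unfold affSubst
  rw [map_add]

/-- `f ↦ f(Ax + b)` is multiplicative (it is an algebra homomorphism). [cite: MediniShpilka2021, §1.1.6 eq. (2) (CCC p.19:9)] -/
theorem affSubst_mul (h : m ≤ n) (A : Matrix (Fin n) (Fin n) K) (b : Fin n → K)
    (p q : MvPolynomial (Fin m) K) : affSubst h A b (p * q) = affSubst h A b p * affSubst h A b q := by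
  unfold affSubst
  rw [map_mul]

/-- `f(Ax + b)` of a constant is that constant. [cite: MediniShpilka2021, §1.1.6 eq. (2) (CCC p.19:9)] -/
theorem affSubst_C (h : m ≤ n) (A : Matrix (Fin n) (Fin n) K) (b : Fin n → K) (c : K) :
    affSubst h A b (C c) = C c := by
  unfold affSubst
  rw [aeval_C, algebraMap_eq]

/-- Consequence of **Lemma 3.8** used in the induction: if `(∂g/∂y_{i₀})(ℓ(x) + b)` — the directional
derivative of `f = g(ℓ(x) + b)` along the dual vector `v_{i₀}` (toolkit
`MS2021.sum_C_mul_pderiv_affSubst`) — survives composition with `H`, then so does some coordinate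
partial derivative `∂f/∂x_j` ("the condition `∂f/∂v ∘ H ≠ 0` implies that there exists some
`i ∈ [n]` such that `∂f/∂x_i ∘ H ≠ 0`").
[cite: MediniShpilka2021, Lemma 3.8 and proof of Lemma 3.9 (arXiv p0017:L60 – p0018:L4)] -/
theorem exists_bind₁_pderiv_affSubst_ne_zero {ρ : Type*} (h : m ≤ n) {A : Matrix (Fin n) (Fin n) K}
    (hA : IsUnit A.det) (b : Fin n → K) (g : MvPolynomial (Fin m) K) (i₀ : Fin m)
    (H : Fin n → MvPolynomial ρ K) (hne : bind₁ H (affSubst h A b (pderiv i₀ g)) ≠ 0) :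
    ∃ j, bind₁ H (pderiv j (affSubst h A b g)) ≠ 0 := by
  by_contra hall
  push Not at hall
  apply hne
  rw [← sum_C_mul_pderiv_affSubst h hA b g i₀, map_sum]
  refine Finset.sum_eq_zero fun j _ => ?_
  rw [map_mul, hall j, mul_zero]

end Lemma38

/-! ### The induction on the number of leaves (printed: "by induction on the number of variables in
the underlying ROF, which we denote by `m`") -/

section Induction

variable {K : Type*} [Field K]

/-- `bind₁ G` of a constant is that constant. [folklore] -/
private theorem bind₁_affSubst_C {m n : ℕ} {τ : Type*} (G : Fin n → MvPolynomial τ K) (h : m ≤ n)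
    (A : Matrix (Fin n) (Fin n) K) (b : Fin n → K) (c : K) :
    bind₁ G (affSubst h A b (C c)) = C c := by
  rw [affSubst_C, bind₁_C_right]

/-- A polynomial of total degree `0` is the constant `C (coeff 0 p)`. [folklore] -/
private theorem eq_C_of_totalDegree_eq_zero {σ : Type*} {p : MvPolynomial σ K}
    (hp : p.totalDegree = 0) : p = C (coeff 0 p) :=
  totalDegree_eq_zero_iff_eq_C.mp hp

/-- Adding a constant to a non-constant polynomial keeps it non-constant. [folklore] -/
private theorem totalDegree_add_C_ne_zero {σ : Type*} {p : MvPolynomial σ K} (hp : p.totalDegree ≠ 0)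
    (c : K) : (p + C c).totalDegree ≠ 0 := by
  rw [totalDegree_add_eq_left_of_totalDegree_lt]
  · exact hp
  · rw [totalDegree_C]
    exact Nat.pos_of_ne_zero hp

/-- **The stronger claim of the printed proof** ("Let `Φ` be a ROF on `m ≤ 2^t` many variables that
computes a non-constant polynomial. Then, for `f ∈ Φ^{GLaff_n(F)}` and any `(t+1)`-independent map
`G`, over `F`, `f ∘ G` is a non-constant polynomial"), by strong induction on the number of leaves
(`N` bounds `|S|`), with the printed case analysis on the top gate: leaf (a nonzero linear form —
(obs:kwise), here via Lemma 3.9 with the constant derivative `∂f/∂x_j = α A_{ij} ≠ 0`), `Φ₁ + Φ₂ + α`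
(derivative at a leaf of the smaller non-constant side, Lemma 3.8, induction with the
`t`-independent part, Lemma 3.9), `Φ₁ × Φ₂ + α` (product of two nonzero polynomials one of which is
non-constant). [cite: MediniShpilka2021, §5.1 proof of Thm 33 (arXiv p0026:L29-L48)] -/
theorem totalDegree_bind₁_affSubst_ne_zero_of_isROP (N : ℕ) :
    ∀ {m : ℕ} (S : Finset (Fin m)) (g : MvPolynomial (Fin m) K), IsROP S g → S.card ≤ N →
      ∀ (t c n : ℕ) (h : m ≤ n) (A : Matrix (Fin n) (Fin n) K) (b : Fin n → K), IsUnit A.det →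
        S.card ≤ 2 ^ t → g.totalDegree ≠ 0 →
          ∀ G : Fin n → MvPolynomial (Fin (t + 1) × (Fin c ⊕ Unit)) K, IsIndependent (t + 1) G →
            (bind₁ G (affSubst h A b g)).totalDegree ≠ 0 := by
  classical
  induction N with
  | zero =>
      intro m S g hg hN
      exact absurd (Finset.card_pos.mpr hg.nonempty) (by omega)
  | succ N ih =>
    intro m S g hg hSN t c n h A b hA hSt hdeg G hG
    -- the `Φ₁ + Φ₂ + α` case with `Φk` the smaller, non-constant side (used twice, by symmetry)
    have addCase : ∀ (Sk So : Finset (Fin m)) (gk go : MvPolynomial (Fin m) K) (α : K),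
        IsROP Sk gk → IsROP So go → Disjoint Sk So → Sk.card ≤ N → (Sk ∪ So).card ≤ 2 ^ t →
        2 * Sk.card ≤ (Sk ∪ So).card → gk.totalDegree ≠ 0 →
          (bind₁ G (affSubst h A b (gk + go + C α))).totalDegree ≠ 0 := by
      intro Sk So gk go α hk ho hd hkN hcard hsmall hgk
      -- `t ≥ 1`: the two sides have at least one leaf each
      obtain ⟨t', rfl⟩ : ∃ t', t = t' + 1 := by
        cases t with
        | zero =>
            exfalso
            have h1 := Finset.card_pos.mpr hk.nonempty
            have h2 := Finset.card_pos.mpr ho.nonempty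
            rw [Finset.card_union_of_disjoint hd] at hcard
            omega
        | succ t' => exact ⟨t', rfl⟩
      have hkt : Sk.card ≤ 2 ^ t' := by
        rw [pow_succ] at hcard
        omega
      -- a leaf `w_{i₀}` of the smaller side with `∂Φk/∂w_{i₀} ≠ 0`
      obtain ⟨i₀, hi₀, hdi₀⟩ := hk.exists_pderiv_ne_zero hgk
      have hi₀o : i₀ ∉ So := fun h' => Finset.disjoint_left.mp hd hi₀ h'
      have hdg : pderiv i₀ (gk + go + C α) = pderiv i₀ gk := by
        rw [map_add, map_add, pderiv_C, add_zero, ho.pderiv_eq_zero_of_not_mem hi₀o, add_zero]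
      -- Lemma 3.9 + Obs 3.1: it suffices that a first-order partial of `f` survives every
      -- `(t'+1)`-independent map `G'`
      refine totalDegree_bind₁_ne_zero_of_isIndependent_succ hG _ fun G' hG' => ?_
      -- which follows from Lemma 3.8 and the induction hypothesis for `∂Φk/∂w_{i₀}`
      refine exists_bind₁_pderiv_affSubst_ne_zero h hA b _ i₀ G' ?_
      rw [hdg]
      by_cases hdc : (pderiv i₀ gk).totalDegree = 0
      · -- a nonzero constant derivative survives any substitution
        rw [eq_C_of_totalDegree_eq_zero hdc, bind₁_affSubst_C, Ne, C_eq_zero]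
        intro hc0
        apply hdi₀
        rw [eq_C_of_totalDegree_eq_zero hdc, hc0, C_0]
      · -- a non-constant derivative: induction (it is read-once on `Sk`, `|Sk| ≤ 2^{t'}`)
        have := ih Sk (pderiv i₀ gk) (hk.isROP_pderiv i₀) hkN t' c n h A b hA hkt hdc G' hG'
        intro h0
        rw [h0, totalDegree_zero] at this
        exact this rfl
    cases hg with
    | leaf i α β =>
        -- `Φ = α w_i + β` with `α ≠ 0`; `∂f/∂x_j = α A_{ij}` is a nonzero constant for some `j`
        have hα : α ≠ 0 := by
          rintro rfl
          apply hdeg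
          rw [C_0, zero_mul, zero_add, totalDegree_C]
        refine totalDegree_bind₁_ne_zero_of_isIndependent_succ hG _ fun G' _ => ?_
        -- a nonzero entry in row `i` of the invertible matrix `A`
        obtain ⟨j₀, hj₀⟩ := exists_apply_ne_zero_of_isUnit_det hA (Fin.castLE h i)
        refine ⟨j₀, ?_⟩
        have hpd : pderiv j₀ (affSubst h A b (C α * X i + C β)) = C (α * A (Fin.castLE h i) j₀) := by
          rw [pderiv_affSubst, Finset.sum_eq_single i]
          · rw [map_add, pderiv_C, add_zero, pderiv_C_mul, pderiv_X_self, mul_one, affSubst_C, C_mul]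
          · intro i' _ hi'
            rw [map_add, pderiv_C, add_zero, pderiv_C_mul, pderiv_X_of_ne hi'.symm, mul_zero]
            unfold affSubst
            rw [map_zero, zero_mul]
          · intro hi
            exact absurd (Finset.mem_univ _) hi
        rw [hpd, bind₁_C_right, Ne, C_eq_zero]
        exact mul_ne_zero hα hj₀
    | @add S₁ S₂ g₁ g₂ α h₁ h₂ hd =>
        have hc₁ : S₁.card ≤ N := by
          have := Finset.card_pos.mpr h₂.nonempty
          rw [Finset.card_union_of_disjoint hd] at hSN
          omega
        have hc₂ : S₂.card ≤ N := by
          have := Finset.card_pos.mpr h₁.nonempty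
          rw [Finset.card_union_of_disjoint hd] at hSN
          omega
        by_cases hd₁ : g₁.totalDegree = 0
        · -- `Φ₁` constant: `f ∘ G = (f₂ ∘ G) + const`, and `Φ₂` is non-constant
          have hd₂ : g₂.totalDegree ≠ 0 := by
            intro hd₂
            apply hdeg
            rw [eq_C_of_totalDegree_eq_zero hd₁, eq_C_of_totalDegree_eq_zero hd₂, ← C_add, ← C_add,
              totalDegree_C]
          have ih₂ := ih S₂ g₂ h₂ hc₂ t c n h A b hA
            ((Finset.card_le_card Finset.subset_union_right).trans hSt) hd₂ G hG
          rw [eq_C_of_totalDegree_eq_zero hd₁, affSubst_add, affSubst_add, map_add, map_add,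
            bind₁_affSubst_C, bind₁_affSubst_C, add_comm (C _), add_assoc, ← C_add]
          exact totalDegree_add_C_ne_zero ih₂ _
        by_cases hd₂ : g₂.totalDegree = 0
        · -- `Φ₂` constant, symmetric
          have ih₁ := ih S₁ g₁ h₁ hc₁ t c n h A b hA
            ((Finset.card_le_card Finset.subset_union_left).trans hSt) hd₁ G hG
          rw [eq_C_of_totalDegree_eq_zero hd₂, affSubst_add, affSubst_add, map_add, map_add,
            bind₁_affSubst_C, bind₁_affSubst_C, add_assoc, ← C_add]
          exact totalDegree_add_C_ne_zero ih₁ _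
        -- both sides non-constant: differentiate at a leaf of the smaller side
        by_cases hle : S₁.card ≤ S₂.card
        · refine addCase S₁ S₂ g₁ g₂ α h₁ h₂ hd hc₁ hSt ?_ hd₁
          rw [Finset.card_union_of_disjoint hd]
          omega
        · have hcomm : g₁ + g₂ + C α = g₂ + g₁ + C α := by rw [add_comm g₁ g₂]
          rw [hcomm]
          refine addCase S₂ S₁ g₂ g₁ α h₂ h₁ hd.symm hc₂ ?_ ?_ hd₂
          · rw [Finset.union_comm]
            exact hSt
          · rw [Finset.card_union_of_disjoint hd.symm]
            omega
    | @mul S₁ S₂ g₁ g₂ α h₁ h₂ hd =>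
        have hc₁ : S₁.card ≤ N := by
          have := Finset.card_pos.mpr h₂.nonempty
          rw [Finset.card_union_of_disjoint hd] at hSN
          omega
        have hc₂ : S₂.card ≤ N := by
          have := Finset.card_pos.mpr h₁.nonempty
          rw [Finset.card_union_of_disjoint hd] at hSN
          omega
        -- `Φ₁ Φ₂` is non-constant: both factors nonzero, one of them non-constant
        have hprod : (g₁ * g₂).totalDegree ≠ 0 := by
          intro h0
          apply hdeg
          rw [eq_C_of_totalDegree_eq_zero h0, ← C_add, totalDegree_C]
        have hg₁0 : g₁ ≠ 0 := by
          rintro rfl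
          exact hprod (by rw [zero_mul, totalDegree_zero])
        have hg₂0 : g₂ ≠ 0 := by
          rintro rfl
          exact hprod (by rw [mul_zero, totalDegree_zero])
        rw [totalDegree_mul_of_isDomain hg₁0 hg₂0] at hprod
        -- the images `fᵢ ∘ G`: nonzero, and non-constant as soon as `Φᵢ` is
        have himg : ∀ (Si : Finset (Fin m)) (gi : MvPolynomial (Fin m) K), IsROP Si gi →
            Si.card ≤ N → Si ⊆ S₁ ∪ S₂ → gi ≠ 0 →
            bind₁ G (affSubst h A b gi) ≠ 0 ∧
              (gi.totalDegree ≠ 0 → (bind₁ G (affSubst h A b gi)).totalDegree ≠ 0) := by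
          intro Si gi hi hci hsub hgi0
          by_cases hdi : gi.totalDegree = 0
          · refine ⟨?_, fun h' => absurd hdi h'⟩
            rw [eq_C_of_totalDegree_eq_zero hdi, bind₁_affSubst_C, Ne, C_eq_zero]
            intro hc0
            apply hgi0
            rw [eq_C_of_totalDegree_eq_zero hdi, hc0, C_0]
          · have ihi := ih Si gi hi hci t c n h A b hA ((Finset.card_le_card hsub).trans hSt) hdi G hG
            refine ⟨?_, fun _ => ihi⟩
            intro h0
            rw [h0, totalDegree_zero] at ihi
            exact ihi rfl
        obtain ⟨hF₁, hF₁'⟩ := himg S₁ g₁ h₁ hc₁ Finset.subset_union_left hg₁0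
        obtain ⟨hF₂, hF₂'⟩ := himg S₂ g₂ h₂ hc₂ Finset.subset_union_right hg₂0
        rw [affSubst_add, affSubst_mul, map_add, map_mul, bind₁_affSubst_C]
        refine totalDegree_add_C_ne_zero ?_ α
        rw [totalDegree_mul_of_isDomain hF₁ hF₂]
        by_cases hd₁ : g₁.totalDegree = 0
        · have hd₂ : g₂.totalDegree ≠ 0 := by omega
          have := hF₂' hd₂
          omega
        · have := hF₁' hd₁
          omega

end Induction

end MS2021

/-! ### The theorem -/

section Thm33

open MS2021

/-- **MS Thm 33 holds** (arXiv ‹thm:PITROPINV›): for `0 ≠ f ∈ ROF^{GLaff_n(F)}` whose underlying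
read-once formula has `2^t` leaves (`2^t ≤ n`) and any `(t+1)`-independent polynomial map `G` over
`F`, `f ∘ G ≠ 0`. Printed proof: the stronger non-constancy claim by induction on the number of
variables of the ROF (`MS2021.totalDegree_bind₁_affSubst_ne_zero_of_isROP`); a nonzero constant
`f` is trivially preserved. [cite: MediniShpilka2021, Thm 33 (CCC p.19:13) and its proof (arXiv §5.1 p0026:L29-L48)] -/
theorem MS2021_thm_33_holds : MS2021_thm_33 := by
  intro K _ n m t c S g hg hS _h2n f hf hf0 G hG
  classical
  obtain ⟨h, A, b, hA, rfl⟩ := hf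
  by_cases hdeg : g.totalDegree = 0
  · -- `g` is a nonzero constant
    rw [totalDegree_eq_zero_iff_eq_C] at hdeg
    rw [hdeg, MS2021.affSubst_C] at hf0 ⊢
    rw [bind₁_C_right, Ne, C_eq_zero]
    rw [Ne, C_eq_zero] at hf0
    exact hf0
  · have key := MS2021.totalDegree_bind₁_affSubst_ne_zero_of_isROP S.card S g hg le_rfl t c n h A b
      hA (hS ▸ le_rfl) hdeg G hG
    intro h0
    rw [h0, totalDegree_zero] at key
    exact key rfl

end Thm33


end Literature.Computability.AlgebraicComplexity

end
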